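import Literature.Probability.RandomPlanarGeometry.WholePlaneSLEIncrements
import HarnessLib

/-!
# The driving increments of the stationary angle law are locally generated, a.s. (every `κ ≠ 8`)

Topic `Probability/RandomPlanarGeometry`; theorems only (no definition, no named fact). The
`κ ≤ 4`-free companions of `RadialHorizonCausality` / `WholePlaneSLEIncrements`: the same null-set
transfer, with the chordal input "generated by a curve" (Rohde–Schramm Thm. 5.1 for a general
Brownian motion, `ae_isGeneratedByCurve_of_isBrownianReal`, `κ ≠ 8`) in place of "simple"
(Thm. 6.1, `κ ≤ 4`), so that the radial curve lives in the CLOSED disc: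

* `RadialSLE.LocallyGenerated.of_eqOn` — local generation is causal;
* `RadialSLE.ae_locallyGenerated_stopPath'` — for every Brownian motion and `κ ≠ 8`, the
  `T`-stopped driving path is a.s. locally generated up to its path horizon;
* `IsStationaryAngleLaw.ae_locallyGenerated_angleIncrPath` — under a stationary SLE_κ(ρ) angle
  law with `κ ≠ 8`, from every base time `b`, almost surely the radial Loewner chain of the
  increment path is locally generated by a curve up to the path horizon.

## References

* J. Miller, S. Sheffield, *Imaginary geometry IV*, PTRF 169 (2017), arXiv:1302.4738, Prop. 2.5
  (proof) and §2.1. [MillerSheffield2013]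
* G. F. Lawler, *Conformally Invariant Processes in the Plane*, AMS (2005), §6.5. [Lawler2005]
-/

noncomputable section

open MeasureTheory ProbabilityTheory Filter Topology Set Metric
open scoped NNReal ENNReal Real

namespace Literature.Probability.RandomPlanarGeometry

open scoped PathBorel
open RadialSLE RadialLoewner

namespace RadialSLE

open SchrammWilson Literature.Probability.Process Literature.Analysis.FunctionSpaces

/-- **Local generation up to `u₁ ≤ T` depends on the driver on `[0, T]` only.**
[cite: Lawler2005, §4.2] -/
theorem LocallyGenerated.of_eqOn {V V' : ℝ≥0 → ℝ} {u₁ : ℝ} (h : LocallyGenerated V u₁)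
    (hV : Continuous V) (hV' : Continuous V') {T : ℝ≥0} (heq : ∀ s : ℝ≥0, s ≤ T → V s = V' s)
    (hu₁ : u₁ ≤ T) : LocallyGenerated V' u₁ := by
  intro u₂ hu₂
  obtain ⟨η, h1, h2, h3, h5⟩ := h u₂ hu₂
  refine ⟨η, h1, h2, h3, fun u hu ↦ ?_⟩
  have huT : u ≤ T := by
    have : (u : ℝ) ≤ T := ((NNReal.coe_le_coe.2 hu).trans hu₂.le).trans hu₁
    exact_mod_cast this
  have heq' : ∀ s : ℝ≥0, s ≤ u → V s = V' s := fun s hs ↦ heq s (hs.trans huT)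
  obtain ⟨hdom, htip⟩ := h5 u hu
  refine ⟨?_, ?_⟩
  · rw [← RadialLoewner.Disc.domain_eq_of_eqOn hV hV' heq', hdom]
  · rw [← heq u huT]
    refine htip.congr' ?_
    filter_upwards [Ioo_mem_nhdsLT (show (0 : ℝ) < 1 by norm_num)] with r hr
    refine RadialLoewner.Disc.invFunOn_map_eq_of_eqOn hV hV' heq' ?_
    rw [mem_ball_zero_iff, norm_mul, Complex.norm_exp_ofReal_mul_I, mul_one, Complex.norm_real,
      Real.norm_eq_abs, abs_of_pos hr.1]
    exact hr.2

variable {Ω : Type*} {mΩ : MeasurableSpace Ω} {κ : ℝ≥0} {B : ℝ≥0 → Ω → ℝ} {P : Measure Ω}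

/-- **For every Brownian motion and `κ ≠ 8`, the `T`-stopped driving path is almost surely locally
generated up to the horizon** (`ae_of_chordal` with the chordal input "generated by a curve",
Rohde–Schramm Thm. 5.1 for a general Brownian motion, and the causal consequence
`u₁ ≤ T → LocallyGenerated (V(· ∧ T)) u₁`). [cite: Lawler2005, §6.5 Prop. 6.21] -/
theorem ae_locallyGenerated_stopPath [IsProbabilityMeasure P] (hB : IsBrownianReal B P)
    (hBm : ∀ t, Measurable (B t)) (hBc : ∀ ω, Continuous (B · ω)) (hB0 : ∀ ω, B 0 ω = 0)
    (hκ : 0 < κ) (h8 : κ ≠ 8) {n : ℕ} {ε : ℝ} (hε : 0 < ε) (hε2 : ε < π / 2) (hnε : 2 * level n < ε / 2)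
    (T : ℝ≥0) :
    ∀ᵐ ω ∂P, LocallyGenerated (stopPath T (bmDriving κ B ω)) (horizon κ B hBc n ε T ω) := by
  have h := ae_of_chordal hB hBm hBc hB0 hκ hε hε2 hnε T (fun _ ↦ True)
    (fun P' _ B' hB' _ hB'c ↦ by
      filter_upwards [ae_isGeneratedByCurve_of_isBrownianReal hB' hB'c hκ.ne' h8] with p ⟨γ, hγ⟩
      exact ⟨γ, hγ, trivial⟩)
    (fun V u₁ ↦ u₁ ≤ T → LocallyGenerated (stopPath T V) u₁)
    (fun hu₁ hY hYI hV hV0 hYeq _ hWt hagree _ hγ _ hu₁T ↦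
      (locallyGenerated_of_agree hu₁ hY hYI hV hV0 hYeq hWt hagree hγ).of_eqOn hV
        (continuous_stopPath T hV) (fun s hs ↦ (stopPath_eq_of_le _ hs).symm) hu₁T)
  filter_upwards [h] with ω hω using hω (by exact_mod_cast horizon_le n ε T ω)

/-- The same, with the horizon read off the stopped path itself. [cite: Lawler2005, §6.5 Prop. 6.21] -/
theorem ae_locallyGenerated_stopPath' [IsProbabilityMeasure P] (hB : IsBrownianReal B P)
    (hBm : ∀ t, Measurable (B t)) (hBc : ∀ ω, Continuous (B · ω)) (hB0 : ∀ ω, B 0 ω = 0)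
    (hκ : 0 < κ) (h8 : κ ≠ 8) {n : ℕ} {ε : ℝ} (hε : 0 < ε) (hε2 : ε < π / 2) (hnε : 2 * level n < ε / 2)
    (T : ℝ≥0) :
    ∀ᵐ ω ∂P, LocallyGenerated (stopPath T (bmDriving κ B ω))
      (pathHorizon n ε T ⟨stopPath T (bmDriving κ B ω), continuous_stopPath T (continuous_bmDriving hBc ω)⟩) := by
  filter_upwards [ae_locallyGenerated_stopPath hB hBm hBc hB0 hκ h8 hε hε2 hnε T] with ω hω
  rwa [show (⟨stopPath T (bmDriving κ B ω), continuous_stopPath T (continuous_bmDriving hBc ω)⟩ : CPath) =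
      ⟨stopPath T (bmPath κ B hBc ω).1, continuous_stopPath T (bmPath κ B hBc ω).2⟩ from rfl,
    pathHorizon_stopPath, ← horizon_eq_pathHorizon]

end RadialSLE

variable {κ : ℝ≥0} {ρ : ℝ} {P : Measure C(ℝ, ℝ)}

/-- **Under a stationary SLE_κ(ρ) angle law (`κ ≠ 8`), from every base time the increment path is
a.s. locally generated by a curve (in the closed disc) up to its path horizon.** As
`ae_locallyGeneratedSimple_angleIncrPath`: the bad set of paths is null for the stopped path of
every Brownian motion (`RadialSLE.ae_locallyGenerated_stopPath'`), hence for the stopped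
normalised increment (`IsStationaryAngleLaw.drivingIncrement_shift_null_of_brownian_null`), and the
unstopped increment has the same horizon and the same local generation.
[cite: MillerSheffield2013, Prop. 2.5 (proof)] -/
theorem IsStationaryAngleLaw.ae_locallyGenerated_angleIncrPath (hP : IsStationaryAngleLaw κ ρ P)
    (hκ : 0 < κ) (h8 : κ ≠ 8) (b : ℝ) {n : ℕ} {ε : ℝ} (hε : 0 < ε) (hε2 : ε < π / 2)
    (hnε : 2 * level n < ε / 2) (T : ℝ≥0) :
    ∀ᵐ x ∂P, ∃ hc : Continuous (angleIncrPath x b),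
      LocallyGenerated (angleIncrPath x b) (pathHorizon n ε T ⟨angleIncrPath x b, hc⟩) := by
  have hsq0 : 0 < Real.sqrt κ := Real.sqrt_pos.2 (by exact_mod_cast hκ)
  have hsq : Real.sqrt κ ≠ 0 := hsq0.ne'
  have good_congr : ∀ {f g : ℝ≥0 → ℝ}, f = g → (∃ hc : Continuous f,
      LocallyGenerated f (pathHorizon n ε T ⟨f, hc⟩)) →
      ∃ hc : Continuous g, LocallyGenerated g (pathHorizon n ε T ⟨g, hc⟩) := by
    rintro f g rfl h; exact h
  set Bad : Set (ℝ≥0 → ℝ) := {p | ¬ ∃ hc : Continuous (fun u ↦ Real.sqrt κ * p u),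
    LocallyGenerated (fun u ↦ Real.sqrt κ * p u)
      (pathHorizon n ε T ⟨fun u ↦ Real.sqrt κ * p u, hc⟩)} with hBad_def
  have hBad : ∀ (Ω' : Type) [MeasurableSpace Ω'] (P' : Measure Ω') [IsProbabilityMeasure P']
      (B : ℝ≥0 → Ω' → ℝ), IsBrownianReal B P' → (∀ t, Measurable (B t)) →
      (∀ ω, Continuous (B · ω)) → P' {ω | (fun t ↦ B (min t T) ω) ∈ Bad} = 0 := by
    intro Ω' _ P' _ B hB hBm hBc
    set B' : ℝ≥0 → Ω' → ℝ := fun t ω ↦ B (0 + t) ω - B 0 ω with hB'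
    have hB'BM : IsBrownianReal B' P' := hB.shift 0
    have hB'm : ∀ t, Measurable (B' t) := fun t ↦ (hBm _).sub (hBm 0)
    have hB'c : ∀ ω, Continuous (B' · ω) := fun ω ↦
      ((hBc ω).comp (continuous_const.add continuous_id)).sub continuous_const
    have hB'0 : ∀ ω, B' 0 ω = 0 := fun ω ↦ by simp [hB']
    have h1 := ae_locallyGenerated_stopPath' hB'BM hB'm hB'c hB'0 hκ h8 hε hε2 hnε T
    have h2 := hB.eval_zero_ae_eq_zero
    have h12 := ae_iff.1 (h1.and h2)
    refine measure_mono_null (fun ω hω ↦ ?_) h12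
    simp only [mem_setOf_eq, not_and_or]
    by_contra hgood
    push Not at hgood
    obtain ⟨hg1, hg2⟩ := hgood
    have heq : stopPath T (bmDriving κ B' ω) = fun u ↦ Real.sqrt κ * B (min u T) ω := by
      funext u
      simp only [stopPath_apply, bmDriving, hB', zero_add]
      rw [show B 0 ω = 0 from hg2, sub_zero]
    exact hω (good_congr heq ⟨_, hg1⟩)
  have hnull := hP.drivingIncrement_shift_null_of_brownian_null hκ b T hBad
  have hIoo : ∀ᵐ x ∂P, ∀ t : ℝ, x t ∈ Ioo 0 (2 * π) := hP.2.1
  have hae : ∀ᵐ x ∂P, (fun t : ℝ≥0 ↦ (x (b + min (t : ℝ) T) - x b -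
      ∫ u in b..(b + min (t : ℝ) T), Real.cot (x u / 2)) / Real.sqrt κ) ∉ Bad := by
    rw [ae_iff]; simpa only [not_not] using hnull
  filter_upwards [hae, hIoo] with x hx hxI
  simp only [hBad_def, mem_setOf_eq, not_not] at hx
  have heq : (fun u : ℝ≥0 ↦ Real.sqrt κ * ((x (b + min (u : ℝ) T) - x b -
      ∫ s in b..(b + min (u : ℝ) T), Real.cot (x s / 2)) / Real.sqrt κ)) =
      stopPath T (angleIncrPath x b) := by
    funext u
    rw [mul_div_cancel₀ _ hsq, stopPath_apply, angleIncrPath_apply, NNReal.coe_min]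
  obtain ⟨hcT, hLG⟩ := good_congr heq hx
  have hc : Continuous (angleIncrPath x b) := continuous_angleIncrPath hxI b
  refine ⟨hc, ?_⟩
  have hhor : pathHorizon n ε T ⟨stopPath T (angleIncrPath x b), hcT⟩ =
      pathHorizon n ε T ⟨angleIncrPath x b, hc⟩ :=
    pathHorizon_eq_of_eqOn n ε fun t ht ↦ (stopPath_eq_of_le (angleIncrPath x b) ht : _)
  rw [hhor] at hLG
  exact hLG.of_eqOn hcT hc (fun s hs ↦ stopPath_eq_of_le _ hs) (by exact_mod_cast pathHorizon_le n ε T _)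

end Literature.Probability.RandomPlanarGeometry
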